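import Literature.AlgebraicTopology.SingularHomology.RelativeMayerVietorisPairs
import Literature.AlgebraicTopology.SingularHomology.CompactSupport
import HarnessLib

/-!
# Generation of `H_q(X | S)` by the local pieces `H_q(B | S)` of an open cover of `S`, one degree
# above the vanishing range

A. Hatcher, *Algebraic Topology* (2002), §3.3, the method of proof of Lemma 3.36 / Thm. 3.35
(pp. 246–248: Mayer–Vietoris induction over finite unions of small open sets, then compact
supports, Prop. 3.33, for arbitrary unions) applied to the relative Mayer–Vietoris sequence of
the pairs `(U, U ∖ S)`, `(V, V ∖ S)` (§2.2 p. 152; the tree's `pairMV`, file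
`RelativeMayerVietorisPairs`). For a closed `S ⊆ X` write `H_q(W | S) = H_q(W, W ∖ S)` for open
`W ⊆ X` (`localHomologyOfSet R M ↥W (val ⁻¹' S) q`). If `H_j(W | S) = 0` for ALL open `W` and
`j + 1 = q` (no hypothesis when `q = 0`), then:

* `localHomologyOfSet.range_inclMap_accumulate_le` — **finite unions**: the image of
  `H_q(B₀ ∪ ⋯ ∪ Bₘ | S)` in `H_q(W | S)` (`W ⊇ B₀ ∪ ⋯ ∪ Bₘ`) lies in the sum of the images of the
  `H_q(Bᵢ | S)` (induction on `m`: `H_q(U | S) ⊕ H_q(V | S) → H_q(U ∪ V | S)` is onto because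
  `H_{q-1}(U ∩ V | S) = 0`, `pairMV.hDiff_surjective_of_isZero`; `pairMV.hDiff_zero_surjective` for
  `q = 0`);
* `localHomologyOfSet.exists_eq_toAmbient_of_iUnion` — **compact supports for `H_q(X | S)`**: along
  an increasing open exhaustion `W₀ ⊆ W₁ ⊆ ⋯` of `X`, every class of `H_q(X | S)` is the image of a
  class of some `H_q(Wₘ | S)` (a relative cycle is a finite chain; Hatcher Prop. 3.33 / proof of
  Prop. 2B.1; the tree's `CChain.exists_carrier_subset`);
* `localHomologyOfSet.exists_inclMap_eq_zero_of_iUnion` — the injectivity half of compact supports: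
  a class of `H_q(W₀ | S)` dying in `H_q(X | S)` dies in some `H_q(Wₘ | S)`;
* **`localHomologyOfSet.mem_iSup_range_toAmbient_of_cover`** — for `X` second countable and ANY
  family `𝓑` of open sets covering `S`: `H_q(X | S) = Σ_{B ∈ 𝓑} im (H_q(B | S) → H_q(X | S))`;
  `localHomologyOfSet.mem_iSup_range_inclMap_of_cover` — the same inside an open `U ⊆ X`
  (`H_q(U | S) = Σ_{B ∈ 𝓑} im (H_q(B | S) → H_q(U | S))` for open `B ⊆ U` covering `S ∩ U`).

This is the generation half of the Thom isomorphism for a closed locally flat `S` of codimension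
`k` (where `H_j(W | S) = 0` for `j < k` by the tree's `LocallyFlatComplement`): `H_k(X | S)` is
spanned by the classes of small transverse discs. Everything is proved; no named facts; the only
definitions are the two abbreviations `inclMap`, `toAmbient` for the maps of pairs induced by
inclusions.

## References

* [HatcherAT2002] A. Hatcher, Algebraic Topology, CUP 2002, §2.2 p. 152, §3.3 Prop. 3.33,
  Lemma 3.36 and proof of Thm. 3.35 (pp. 246–248), proof of Prop. 2B.1.
-/

noncomputable section

-- as in `SingularChainsConcrete` / `LocalHomology`: chains of the concrete complex are `Finsupp`s
-- up to unfolding of semireducible definitions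
set_option backward.isDefEq.respectTransparency false

open CategoryTheory Limits Set TopologicalSpace

universe u v

namespace Literature.AlgebraicTopology.SingularHomology

namespace localHomologyOfSet

variable (R : Type v) [CommRing R] (M : Type v) [AddCommGroup M] [Module R M]
variable {X : Type u} [TopologicalSpace X] {S : Set X}

/-! ### The maps of pairs induced by inclusions -/

/-- **`H_q(W | S) → H_q(W' | S)` for `W ⊆ W'`**: the map of pairs `(↥W, W ↓∖ S) → (↥W', W' ↓∖ S)`
induced by the inclusion (Hatcher 2002, §2.1, maps of pairs). [cite: HatcherAT2002, §2.2 p. 152] -/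
abbrev inclMap {W W' : Set X} (h : W ⊆ W') (q : ℕ) :
    localHomologyOfSet R M (↥W) (Subtype.val ⁻¹' S) q ⟶ localHomologyOfSet R M (↥W') (Subtype.val ⁻¹' S) q :=
  relativeSingularHomology.map R M (subsetInclusion h) (relOpenMV.mapsTo_inclusion_compl h S) q

variable (S) in
/-- **`H_q(W | S) → H_q(X | S)`**: the map of pairs `(↥W, W ↓∖ S) → (X, X ∖ S)` induced by the
inclusion (Hatcher 2002, §3.3 p. 233). [cite: HatcherAT2002, §3.3 p. 233] -/
abbrev toAmbient (W : Set X) (q : ℕ) :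
    localHomologyOfSet R M (↥W) (Subtype.val ⁻¹' S) q ⟶ localHomologyOfSet R M X S q :=
  relativeSingularHomology.map R M (subsetIncl W) (mapsTo_val_compl W S) q

/-- Inclusions compose. [folklore] -/
@[reassoc]
lemma inclMap_comp_inclMap {W W' W'' : Set X} (h : W ⊆ W') (h' : W' ⊆ W'') (q : ℕ) :
    inclMap R M (S := S) h q ≫ inclMap R M h' q = inclMap R M (h.trans h') q := by
  rw [← relativeSingularHomology.map_comp]
  rfl

/-- Inclusion then ambient is ambient. [folklore] -/
@[reassoc]
lemma inclMap_comp_toAmbient {W W' : Set X} (h : W ⊆ W') (q : ℕ) :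
    inclMap R M h q ≫ toAmbient R M S W' q = toAmbient R M S W q := by
  rw [← relativeSingularHomology.map_comp]
  rfl

/-- Off `S` the groups vanish: `H_q(B | S) = H_q(B, B) = 0` for `B ⊆ X ∖ S`. [folklore] -/
lemma isZero_of_subset_compl {B : Set X} (hB : B ⊆ Sᶜ) (q : ℕ) :
    IsZero (localHomologyOfSet R M (↥B) (Subtype.val ⁻¹' S) q) := by
  have h : (Subtype.val ⁻¹' S : Set ↥B)ᶜ = univ :=
    eq_univ_of_forall fun b hb ↦ hB b.2 hb
  change IsZero (relativeSingularHomology R M (↥B) (Subtype.val ⁻¹' S)ᶜ q)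
  rw [h]
  exact isZero_relativeSingularHomology_univ R M q

/-! ### Compact supports: classes of `H_q(X | S)` along an open exhaustion -/

variable (S) in
/-- **Compact supports for `H_q(X | S)`** (Hatcher 2002, Prop. 3.33 and proof of Prop. 2B.1): if
`W₀ ⊆ W₁ ⊆ ⋯` are open with `⋃ Wₘ = X`, every class of `H_q(X | S) = H_q(X, X ∖ S)` is the image of
a class of `H_q(Wₘ | S)` for some `m` — a relative cycle is a finite chain, carried by some `Wₘ`,
and its boundary, carried by `X ∖ S`, is then carried by `Wₘ ∖ S`. [cite: HatcherAT2002, §3.3 Prop. 3.33] -/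
theorem exists_eq_toAmbient_of_iUnion (W : ℕ → Set X) (hWo : ∀ m, IsOpen (W m)) (hWm : Monotone W)
    (hV : ⋃ m, W m = Set.univ) (q : ℕ) (x : localHomologyOfSet R M X S q) :
    ∃ (m : ℕ) (x' : localHomologyOfSet R M (↥(W m)) (Subtype.val ⁻¹' S) q),
      toAmbient R M S (W m) q x' = x := by
  -- a concrete representative `z` (a chain of `X` with `∂z` carried by `X ∖ S`)
  set y := (relativeSingularHomology.concreteIso R M X Sᶜ q).hom x with hy
  obtain ⟨z, hz, hyz⟩ := (chainsInSub R M X Sᶜ).relCls_surjective y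
  -- `z` is carried by some `W m`, hence lifts to a chain `zm` of `↥(W m)`
  obtain ⟨m, hm⟩ := CChain.exists_carrier_subset M W hWo hWm z (by rw [hV]; exact subset_univ _)
  obtain ⟨zm, hzm⟩ := csingularChainComplex.exists_map_val_eq_of_carrier_subset (R := R) z hm
  -- `zm` is a relative cycle of `(↥(W m), W m ↓∖ S)`
  have hdzm : (csingularChainComplex R M ↥(W m)).d q ((ComplexShape.down ℕ).next q) zm ∈
      chainsInSub R M (↥(W m)) (Subtype.val ⁻¹' S)ᶜ ((ComplexShape.down ℕ).next q) := by
    change _ ∈ chainsInSub R M (↥(W m)) (Subtype.val ⁻¹' Sᶜ) ((ComplexShape.down ℕ).next q)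
    rw [chainsInSub_preimage_val, Subcomplex.mem_comap, ← csingularChainComplex.d_map_f_apply, hzm]
    exact hz
  refine ⟨m, (relativeSingularHomology.concreteIso R M (↥(W m)) (Subtype.val ⁻¹' S)ᶜ q).inv
    ((chainsInSub R M (↥(W m)) (Subtype.val ⁻¹' S)ᶜ).relCls zm hdzm), ?_⟩
  rw [toAmbient, relativeSingularHomology.map_eq_concrete, ModuleCat.comp_apply, ModuleCat.comp_apply,
    Iso.inv_hom_id_apply, Subcomplex.homologyMap_quotMap_relCls]
  have e : (chainsInSub R M X Sᶜ).relCls ((csingularChainComplex.map R M (subsetIncl (W m))).f q zm)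
      (Subcomplex.d_f_mem _ _ _ (chainsInSub_le_comap_map R M (subsetIncl (W m))
        (mapsTo_val_compl (W m) S)) zm hdzm) = y := by
    rw [← hyz]
    simp only [hzm]
  rw [e, hy, Iso.hom_inv_id_apply]

variable (S) in
/-- **Compact supports for `H_q(X | S)`, injectivity half** (Hatcher 2002, Prop. 3.33): along an
increasing open exhaustion `W₀ ⊆ W₁ ⊆ ⋯` of `X`, a class of `H_q(W₀ | S)` which vanishes in
`H_q(X | S)` already vanishes in some `H_q(Wₘ | S)` — a relative boundary relation
`z = ∂w + (chain in X ∖ S)` in `X` involves finitely many simplices, all carried by some `Wₘ`.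
[cite: HatcherAT2002, §3.3 Prop. 3.33] -/
theorem exists_inclMap_eq_zero_of_iUnion (W : ℕ → Set X) (hWo : ∀ m, IsOpen (W m)) (hWm : Monotone W)
    (hV : ⋃ m, W m = Set.univ) (q : ℕ) (x : localHomologyOfSet R M (↥(W 0)) (Subtype.val ⁻¹' S) q)
    (hx : toAmbient R M S (W 0) q x = 0) :
    ∃ m : ℕ, inclMap R M (S := S) (hWm (Nat.zero_le m)) q x = 0 := by
  -- a concrete representative `z₀`, a chain of `↥(W 0)`
  set y := (relativeSingularHomology.concreteIso R M (↥(W 0)) (Subtype.val ⁻¹' S)ᶜ q).hom x with hy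
  obtain ⟨z₀, hz₀, hyz⟩ := (chainsInSub R M (↥(W 0)) (Subtype.val ⁻¹' S)ᶜ).relCls_surjective y
  -- in `X`, `val z₀ = ∂w + a` with `a` carried by `X ∖ S`
  have hX : (chainsInSub R M X Sᶜ).relCls ((csingularChainComplex.map R M (subsetIncl (W 0))).f q z₀)
      (Subcomplex.d_f_mem _ _ _ (chainsInSub_le_comap_map R M (subsetIncl (W 0))
        (mapsTo_val_compl (W 0) S)) z₀ hz₀) = 0 := by
    have e := congrArg (relativeSingularHomology.concreteIso R M X Sᶜ q).hom hx
    rw [map_zero, toAmbient, relativeSingularHomology.map_eq_concrete, ModuleCat.comp_apply,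
      ModuleCat.comp_apply, Iso.inv_hom_id_apply, ← hy, ← hyz, Subcomplex.homologyMap_quotMap_relCls] at e
    exact e
  obtain ⟨w, hw⟩ := (Subcomplex.relCls_eq_zero_iff _ _ _).1 hX
  -- `w` is carried by some `W m`
  obtain ⟨m, hm⟩ := CChain.exists_carrier_subset M W hWo hWm w (by rw [hV]; exact subset_univ _)
  obtain ⟨wm, hwm⟩ := csingularChainComplex.exists_map_val_eq_of_carrier_subset (R := R) w hm
  refine ⟨m, ?_⟩
  -- in `↥(W m)`: `incl z₀ = ∂wm + (chain in W m ∖ S)`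
  have hzm : (chainsInSub R M (↥(W m)) (Subtype.val ⁻¹' S)ᶜ).relCls
      ((csingularChainComplex.map R M (subsetInclusion (hWm (Nat.zero_le m)))).f q z₀)
      (Subcomplex.d_f_mem _ _ _ (chainsInSub_le_comap_map R M (subsetInclusion (hWm (Nat.zero_le m)))
        (relOpenMV.mapsTo_inclusion_compl (hWm (Nat.zero_le m)) S)) z₀ hz₀) = 0 := by
    refine (Subcomplex.relCls_eq_zero_iff _ _ _).2 ⟨wm, ?_⟩
    change _ ∈ chainsInSub R M (↥(W m)) (Subtype.val ⁻¹' Sᶜ) q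
    rw [chainsInSub_preimage_val, Subcomplex.mem_comap, map_sub, ← csingularChainComplex.d_map_f_apply,
      hwm, csingularChainComplex.map_f_map_f_apply]
    exact hw
  apply (relativeSingularHomology.concreteIso R M (↥(W m)) (Subtype.val ⁻¹' S)ᶜ q).toLinearEquiv.injective
  rw [map_zero, Iso.toLinearEquiv_apply, inclMap, relativeSingularHomology.map_eq_concrete,
    ModuleCat.comp_apply, ModuleCat.comp_apply, Iso.inv_hom_id_apply, ← hy, ← hyz,
    Subcomplex.homologyMap_quotMap_relCls]
  exact hzm

/-! ### Finite unions: Mayer–Vietoris induction -/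

/-- Under the vanishing hypothesis in degree `q - 1` for all open sets (none if `q = 0`),
`H_q(U | S) ⊕ H_q(V | S) → H_q(U ∪ V | S)` is onto for `U`, `V` open and `S` closed.
[cite: HatcherAT2002, §2.2 p. 152] -/
lemma hDiff_surjective_of_vanishing (hS : IsClosed S) (q : ℕ)
    (hvan : ∀ W : Set X, IsOpen W → ∀ j, j + 1 = q →
      IsZero (localHomologyOfSet R M (↥W) (Subtype.val ⁻¹' S) j))
    {U V : Set X} (hU : IsOpen U) (hV : IsOpen V) :
    Function.Surjective (pairMV.hDiff R M S U V q) := by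
  cases q with
  | zero => exact pairMV.hDiff_zero_surjective R M hU hV hS
  | succ j => exact pairMV.hDiff_surjective_of_isZero R M hU hV hS j (hvan _ (hU.inter hV) j rfl)

/-- **Finite unions** (Hatcher 2002, §3.3, the inductive step of Lemma 3.36 / Thm. 3.35, for the
relative Mayer–Vietoris sequence): under the vanishing hypothesis in degree `q - 1` for all open
sets, for open `B₀, B₁, …` and every `W ⊇ B₀ ∪ ⋯ ∪ Bₘ`, the image of `H_q(B₀ ∪ ⋯ ∪ Bₘ | S)` in
`H_q(W | S)` is contained in the sum of the images of the `H_q(Bᵢ | S)`, `i ≤ m`.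
[cite: HatcherAT2002, §3.3 proof of Thm. 3.35 and Lemma 3.36] -/
theorem range_inclMap_accumulate_le (hS : IsClosed S) (q : ℕ)
    (hvan : ∀ W : Set X, IsOpen W → ∀ j, j + 1 = q →
      IsZero (localHomologyOfSet R M (↥W) (Subtype.val ⁻¹' S) j))
    (g : ℕ → Set X) (hg : ∀ i, IsOpen (g i)) :
    ∀ (m : ℕ) (W : Set X) (hW : accumulate g m ⊆ W),
      LinearMap.range (inclMap R M (S := S) hW q).hom ≤
        ⨆ (i : ℕ) (hi : i ≤ m), LinearMap.range
          (inclMap R M (S := S) ((subset_accumulate.trans (monotone_accumulate hi)).trans hW : g i ⊆ W) q).hom := by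
  intro m
  induction m with
  | zero =>
    intro W hW
    rintro _ ⟨x, rfl⟩
    have h0 : accumulate g 0 ⊆ g 0 := (accumulate_zero_nat g).subset
    have e : inclMap R M (S := S) hW q x =
        inclMap R M (S := S) ((subset_accumulate.trans (monotone_accumulate le_rfl)).trans hW : g 0 ⊆ W) q
          (inclMap R M (S := S) h0 q x) := by
      rw [← ModuleCat.comp_apply, inclMap_comp_inclMap]
    rw [e]
    exact Submodule.mem_iSup_of_mem 0 (Submodule.mem_iSup_of_mem le_rfl (LinearMap.mem_range_self _ _))
  | succ m ih =>
    intro W hW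
    rintro _ ⟨x, rfl⟩
    -- `U = B₀ ∪ ⋯ ∪ Bₘ`, `V = B_{m+1}`, `U ∪ V ⊇ B₀ ∪ ⋯ ∪ B_{m+1}`
    have hUo : IsOpen (accumulate g m) := by
      rw [accumulate_def]
      exact isOpen_biUnion fun i _ ↦ hg i
    have hUV : accumulate g (m + 1) ⊆ accumulate g m ∪ g (m + 1) := (accumulate_succ g m).subset
    have hUVW : accumulate g m ∪ g (m + 1) ⊆ W := (accumulate_succ g m).symm.subset.trans hW
    have hUW : accumulate g m ⊆ W := subset_union_left.trans hUVW
    have hVW : g (m + 1) ⊆ W := subset_union_right.trans hUVW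
    obtain ⟨⟨y, z⟩, hyz⟩ := hDiff_surjective_of_vanishing R M hS q hvan hUo (hg (m + 1))
      (inclMap R M (S := S) hUV q x)
    have e : inclMap R M (S := S) hW q x =
        inclMap R M (S := S) hUW q y - inclMap R M (S := S) hVW q z := by
      have e1 : inclMap R M (S := S) hW q x = inclMap R M (S := S) hUVW q (inclMap R M (S := S) hUV q x) := by
        rw [← ModuleCat.comp_apply, inclMap_comp_inclMap]
      rw [e1, ← hyz, pairMV.hDiff_apply, map_sub]
      congr 1
      · rw [← ModuleCat.comp_apply, inclMap_comp_inclMap]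
      · rw [← ModuleCat.comp_apply, inclMap_comp_inclMap]
    rw [e]
    refine Submodule.sub_mem _ ?_ ?_
    · -- the `U`-part, by induction
      have hy : inclMap R M (S := S) hUW q y ∈ ⨆ (i : ℕ) (hi : i ≤ m), LinearMap.range
          (inclMap R M (S := S) ((subset_accumulate.trans (monotone_accumulate hi)).trans hUW : g i ⊆ W) q).hom :=
        ih W hUW (LinearMap.mem_range_self _ _)
      have hle : (⨆ (i : ℕ) (hi : i ≤ m), LinearMap.range
          (inclMap R M (S := S) ((subset_accumulate.trans (monotone_accumulate hi)).trans hUW : g i ⊆ W) q).hom) ≤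
          ⨆ (i : ℕ) (hi : i ≤ m + 1), LinearMap.range
            (inclMap R M (S := S) ((subset_accumulate.trans (monotone_accumulate hi)).trans hW : g i ⊆ W) q).hom :=
        iSup_le fun i ↦ iSup_le fun hi ↦ le_iSup_of_le i (le_iSup_of_le (Nat.le_succ_of_le hi) le_rfl)
      exact hle hy
    · -- the `V`-part
      exact Submodule.mem_iSup_of_mem (m + 1) (Submodule.mem_iSup_of_mem le_rfl (LinearMap.mem_range_self _ _))

/-! ### The theorem: generation by the local pieces of a cover of `S` -/

variable (S) in
/-- **`H_q(X | S)` is generated by the local pieces of an open cover of `S`** (Hatcher 2002, §3.3,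
method of Lemma 3.36 / Thm. 3.35 with Prop. 3.33, for the relative Mayer–Vietoris sequence of
§2.2 p. 152): let `X` be second countable, `S ⊆ X` closed, and suppose `H_j(W | S) = 0` for every
open `W ⊆ X` and `j + 1 = q`. Then for every family `𝓑` of open sets covering `S`, every class of
`H_q(X | S)` is a finite sum of images of classes of the `H_q(B | S)`, `B ∈ 𝓑`:
`H_q(X | S) = Σ_{B ∈ 𝓑} im (H_q(B | S) → H_q(X | S))`. (The open set `X ∖ S`, on which
`H_q(· | S) = 0`, is added to the cover; a countable subcover `B₀, B₁, …` is exhausted by the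
finite unions `B₀ ∪ ⋯ ∪ Bₘ`.) [cite: HatcherAT2002, §3.3 proof of Thm. 3.35, Lemma 3.36 and Prop. 3.33] -/
theorem mem_iSup_range_toAmbient_of_cover [SecondCountableTopology X] (hS : IsClosed S) (q : ℕ)
    (hvan : ∀ W : Set X, IsOpen W → ∀ j, j + 1 = q →
      IsZero (localHomologyOfSet R M (↥W) (Subtype.val ⁻¹' S) j))
    {𝓑 : Set (Set X)} (h𝓑 : ∀ B ∈ 𝓑, IsOpen B) (hcov : S ⊆ ⋃₀ 𝓑) (x : localHomologyOfSet R M X S q) :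
    x ∈ ⨆ B ∈ 𝓑, LinearMap.range (toAmbient R M S B q).hom := by
  -- the cover `𝓑 ∪ {X ∖ S}` of `X` and a countable subcover, enumerated
  set 𝓑' : Set (Set X) := insert Sᶜ 𝓑 with h𝓑'
  have h𝓑'o : ∀ B ∈ 𝓑', IsOpen B := by
    rintro B (rfl | hB)
    · exact hS.isOpen_compl
    · exact h𝓑 B hB
  have h𝓑'cov : ⋃₀ 𝓑' = univ := by
    refine eq_univ_of_forall fun p ↦ ?_
    by_cases hp : p ∈ S
    · obtain ⟨B, hB, hpB⟩ := mem_sUnion.1 (hcov hp)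
      exact mem_sUnion.2 ⟨B, Or.inr hB, hpB⟩
    · exact mem_sUnion.2 ⟨Sᶜ, Or.inl rfl, hp⟩
  obtain ⟨T, hTc, hT𝓑', hTcov⟩ := isOpen_sUnion_countable 𝓑' h𝓑'o
  rw [h𝓑'cov] at hTcov
  set T' : Set (Set X) := insert Sᶜ T with hT'
  have hT'c : T'.Countable := hTc.insert _
  have hT'ne : T'.Nonempty := ⟨Sᶜ, mem_insert _ _⟩
  have hT'𝓑' : T' ⊆ 𝓑' := insert_subset (mem_insert _ _) hT𝓑'
  have hT'cov : ⋃₀ T' = univ := by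
    rw [hT', sUnion_insert, hTcov, union_univ]
  obtain ⟨g, hg⟩ := hT'c.exists_eq_range hT'ne
  have hgo : ∀ i, IsOpen (g i) := fun i ↦ h𝓑'o _ (hT'𝓑' (hg ▸ mem_range_self i))
  have hWU : ⋃ m, accumulate g m = univ := by
    rw [iUnion_accumulate, ← sUnion_range, ← hg, hT'cov]
  have hWo : ∀ m, IsOpen (accumulate g m) := fun m ↦ by
    rw [accumulate_def]
    exact isOpen_biUnion fun i _ ↦ hgo i
  -- compact supports: `x` comes from some `B₀ ∪ ⋯ ∪ Bₘ`
  obtain ⟨m, x', rfl⟩ := exists_eq_toAmbient_of_iUnion R M S (accumulate g) hWo monotone_accumulate hWU q x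
  -- finite unions: inside `↥univ`, then to `X`
  have hx' : inclMap R M (S := S) (subset_univ (accumulate g m)) q x' ∈
      ⨆ (i : ℕ) (hi : i ≤ m), LinearMap.range (inclMap R M (S := S)
        ((subset_accumulate.trans (monotone_accumulate hi)).trans (subset_univ _) : g i ⊆ univ) q).hom :=
    range_inclMap_accumulate_le R M hS q hvan g hgo m univ (subset_univ _) (LinearMap.mem_range_self _ _)
  have e : toAmbient R M S (accumulate g m) q x' =
      toAmbient R M S univ q (inclMap R M (S := S) (subset_univ (accumulate g m)) q x') := by
    rw [← ModuleCat.comp_apply, inclMap_comp_toAmbient]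
  rw [e]
  have hmap : ∀ (i : ℕ) (hi : g i ⊆ univ), Submodule.map (toAmbient R M S univ q).hom
      (LinearMap.range (inclMap R M (S := S) hi q).hom) ≤ ⨆ B ∈ 𝓑, LinearMap.range (toAmbient R M S B q).hom := by
    intro i hi
    rw [← LinearMap.range_comp, ← ModuleCat.hom_comp, inclMap_comp_toAmbient]
    -- `g i ∈ 𝓑'`: either `X ∖ S` (zero group) or a member of `𝓑`
    rcases hT'𝓑' (hg ▸ mem_range_self i) with hgi | hgi
    · rintro _ ⟨w, rfl⟩
      haveI := ModuleCat.subsingleton_of_isZero (isZero_of_subset_compl R M (S := S) hgi.subset q)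
      rw [Subsingleton.elim w 0, map_zero]
      exact Submodule.zero_mem _
    · exact le_iSup_of_le (g i) (le_iSup_of_le hgi le_rfl)
  have hfin : Submodule.map (toAmbient R M S univ q).hom (⨆ (i : ℕ) (hi : i ≤ m), LinearMap.range
      (inclMap R M (S := S) ((subset_accumulate.trans (monotone_accumulate hi)).trans (subset_univ _) :
        g i ⊆ univ) q).hom) ≤ ⨆ B ∈ 𝓑, LinearMap.range (toAmbient R M S B q).hom := by
    rw [Submodule.map_iSup]
    refine iSup_le fun i ↦ ?_
    rw [Submodule.map_iSup]
    exact iSup_le fun hi ↦ hmap i _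
  exact hfin (Submodule.mem_map_of_mem hx')

/-! ### The same inside an open subset `U ⊆ X` -/

/-- Vanishing below the critical degree passes to the open subsets of an open subspace `U`.
[folklore] -/
lemma isZero_localHomologyOfSet_subtype_of_isOpen {U : Set X} (hU : IsOpen U) (q : ℕ)
    (hvan : ∀ W : Set X, IsOpen W → ∀ j, j + 1 = q →
      IsZero (localHomologyOfSet R M (↥W) (Subtype.val ⁻¹' S) j))
    (W' : Set ↥U) (hW' : IsOpen W') (j : ℕ) (hj : j + 1 = q) :
    IsZero (localHomologyOfSet R M (↥W') (Subtype.val ⁻¹' (Subtype.val ⁻¹' S : Set ↥U)) j) := by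
  -- `W' = val ⁻¹' W₀` with `W₀ = val '' W'` open in `X`, `W₀ ⊆ U`
  set W₀ : Set X := Subtype.val '' W' with hW₀
  have hW₀o : IsOpen W₀ := hU.isOpenMap_subtype_val _ hW'
  have hW₀U : W₀ ⊆ U := by
    rintro _ ⟨w, -, rfl⟩
    exact w.2
  have hW'eq : W' = Subtype.val ⁻¹' W₀ := (Subtype.val_injective.preimage_image W').symm
  rw [hW'eq]
  -- transport along `↥(val ⁻¹' W₀) ≃ₜ ↥W₀`
  set e := preimageValHomeomorphOfSubset (X := X) hW₀U with he
  have hm : Set.MapsTo (e : C(↥(Subtype.val ⁻¹' W₀ : Set ↥U), ↥W₀))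
      (Subtype.val ⁻¹' (Subtype.val ⁻¹' S : Set ↥U) : Set ↥(Subtype.val ⁻¹' W₀ : Set ↥U))ᶜ
      (Subtype.val ⁻¹' S : Set ↥W₀)ᶜ := fun _ hx ↦ hx
  have hm' : Set.MapsTo (e.symm : C(↥W₀, ↥(Subtype.val ⁻¹' W₀ : Set ↥U)))
      (Subtype.val ⁻¹' S : Set ↥W₀)ᶜ
      (Subtype.val ⁻¹' (Subtype.val ⁻¹' S : Set ↥U) : Set ↥(Subtype.val ⁻¹' W₀ : Set ↥U))ᶜ :=
    fun _ hx ↦ hx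
  haveI := relativeSingularHomology.isIso_map_homeomorph R M e hm hm' j
  exact IsZero.of_iso (hvan W₀ hW₀o j hj)
    (asIso (relativeSingularHomology.map R M (e : C(_, _)) hm j))

/-- The image of `H_q(↥(U ↓∩ B) | S)` in `H_q(U | S)` (the local piece of the subspace `U`) is the
image of `H_q(B | S) → H_q(U | S)` for `B ⊆ U`. [folklore] -/
lemma range_toAmbient_preimage_eq {U B : Set X} (hBU : B ⊆ U) (q : ℕ) :
    LinearMap.range (toAmbient R M (Subtype.val ⁻¹' S : Set ↥U) (Subtype.val ⁻¹' B : Set ↥U) q).hom =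
      LinearMap.range (inclMap R M (S := S) hBU q).hom := by
  set e := preimageValHomeomorphOfSubset (X := X) hBU with he
  have hm : Set.MapsTo (e : C(↥(Subtype.val ⁻¹' B : Set ↥U), ↥B))
      (Subtype.val ⁻¹' (Subtype.val ⁻¹' S : Set ↥U) : Set ↥(Subtype.val ⁻¹' B : Set ↥U))ᶜ
      (Subtype.val ⁻¹' S : Set ↥B)ᶜ := fun _ hx ↦ hx
  have hm' : Set.MapsTo (e.symm : C(↥B, ↥(Subtype.val ⁻¹' B : Set ↥U)))
      (Subtype.val ⁻¹' S : Set ↥B)ᶜ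
      (Subtype.val ⁻¹' (Subtype.val ⁻¹' S : Set ↥U) : Set ↥(Subtype.val ⁻¹' B : Set ↥U))ᶜ :=
    fun _ hx ↦ hx
  haveI := relativeSingularHomology.isIso_map_homeomorph R M e hm hm' q
  have hfac : toAmbient R M (Subtype.val ⁻¹' S : Set ↥U) (Subtype.val ⁻¹' B : Set ↥U) q =
      relativeSingularHomology.map R M (e : C(_, _)) hm q ≫ inclMap R M (S := S) hBU q := by
    rw [toAmbient, inclMap, ← relativeSingularHomology.map_comp]
    rfl
  rw [hfac, ModuleCat.hom_comp]
  refine LinearMap.range_comp_of_range_eq_top _ (LinearMap.range_eq_top.2 ?_)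
  exact ((ConcreteCategory.isIso_iff_bijective _).1 inferInstance).2

/-- **`H_q(U | S)` is generated by the local pieces of an open cover of `S ∩ U` inside `U`**, for
`U ⊆ X` open (the theorem `mem_iSup_range_toAmbient_of_cover` for the subspace `U`): if
`H_j(W | S) = 0` for all open `W ⊆ X` and `j + 1 = q`, and `𝓑` is a family of open subsets of `U`
covering `S ∩ U`, then every class of `H_q(U | S)` lies in `Σ_{B ∈ 𝓑} im (H_q(B | S) → H_q(U | S))`.
[cite: HatcherAT2002, §3.3 proof of Thm. 3.35, Lemma 3.36 and Prop. 3.33] -/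
theorem mem_iSup_range_inclMap_of_cover [SecondCountableTopology X] (hS : IsClosed S) (q : ℕ)
    (hvan : ∀ W : Set X, IsOpen W → ∀ j, j + 1 = q →
      IsZero (localHomologyOfSet R M (↥W) (Subtype.val ⁻¹' S) j))
    {U : Set X} (hU : IsOpen U) {𝓑 : Set (Set X)} (h𝓑 : ∀ B ∈ 𝓑, IsOpen B)
    (h𝓑U : ∀ B ∈ 𝓑, B ⊆ U) (hcov : S ∩ U ⊆ ⋃₀ 𝓑) (x : localHomologyOfSet R M (↥U) (Subtype.val ⁻¹' S) q) :
    x ∈ ⨆ (B : Set X) (hB : B ∈ 𝓑), LinearMap.range (inclMap R M (S := S) (h𝓑U B hB) q).hom := by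
  -- the theorem for the space `↥U`, the closed set `U ↓∩ S` and the family `{U ↓∩ B}`
  have hSU : IsClosed (Subtype.val ⁻¹' S : Set ↥U) := hS.preimage continuous_subtype_val
  let 𝓑' : Set (Set ↥U) := {B' | ∃ B ∈ 𝓑, B' = Subtype.val ⁻¹' B}
  have h𝓑'o : ∀ B' ∈ 𝓑', IsOpen B' := by
    rintro _ ⟨B, hB, rfl⟩
    exact (h𝓑 B hB).preimage continuous_subtype_val
  have hcov' : (Subtype.val ⁻¹' S : Set ↥U) ⊆ ⋃₀ 𝓑' := by
    intro u hu
    obtain ⟨B, hB, huB⟩ := mem_sUnion.1 (hcov ⟨hu, u.2⟩)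
    exact mem_sUnion.2 ⟨Subtype.val ⁻¹' B, ⟨B, hB, rfl⟩, huB⟩
  have hx := mem_iSup_range_toAmbient_of_cover R M (Subtype.val ⁻¹' S : Set ↥U) hSU q
    (isZero_localHomologyOfSet_subtype_of_isOpen R M hU q hvan) h𝓑'o hcov' x
  have hle : (⨆ B' ∈ 𝓑', LinearMap.range (toAmbient R M (Subtype.val ⁻¹' S : Set ↥U) B' q).hom) ≤
      ⨆ (B : Set X) (hB : B ∈ 𝓑), LinearMap.range (inclMap R M (S := S) (h𝓑U B hB) q).hom := by
    refine iSup_le fun B' ↦ iSup_le ?_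
    rintro ⟨B, hB, rfl⟩
    rw [range_toAmbient_preimage_eq R M (h𝓑U B hB) q]
    exact le_iSup_of_le B (le_iSup_of_le hB le_rfl)
  exact hle hx

end localHomologyOfSet

end Literature.AlgebraicTopology.SingularHomology
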